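import Literature.NumberTheory.EllipticCurves.RealLatticeCovolumeProofs
import Literature.NumberTheory.EllipticCurves.ComplexPeriodProofs
import Literature.NumberTheory.EllipticCurves.RealPeriodProofs
import Literature.NumberTheory.EllipticCurves.QuadraticTwist
import Mathlib.NumberTheory.NumberField.Discriminant.Basic
import HarnessLib

/-!
# The archimedean comparison `Ω(E) · Ω(E^{(D)}) = n · Ω(E_K/K)` for an imaginary quadratic field

Sibling *proofs* file (theorems only, no definitions, no named facts) of
`Literature.NumberTheory.EllipticCurves.BSDQuadraticDescent`, towards its named fact
`WeierstrassCurve.bsdRHS_baseChange_quadratic` (the Birch–Swinnerton-Dyer quotient of `E_K/K` is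
the product of those of `E/ℚ` and `E^{(D)}/ℚ`, `K` imaginary quadratic of discriminant `D`; Milne,
Invent. Math. 17 (1972), §1 Thm. 1 for the Weil restriction `Res_{K/ℚ} E_K ∼ E × E^{(D)}`, in the
quotient form of Dokchitser–Dokchitser, Ann. of Math. 172 (2010), §2.1). This file proves the
**archimedean step** of that comparison — the relation between the period term
`Ω(E_K/K) = 2 covol(Λ)/|d_K|^{1/2}` (`WeierstrassCurve.bsdPeriod`, one complex place, the
normalisation `2∫_{E(K_v)} ω ∧ ω̄` of Dokchitser–Dokchitser, Conj. 2.1 and Burungale–Flach 2024,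
Remark 2) and the real periods `Ω(E) = ∫_{E(ℝ)}|ω|`, `Ω(E^{(D)})` entering `bsdRHS`:

* `WeierstrassCurve.realPeriod_mul_realPeriod_quadraticTwist_mul_sqrt` — for `W` elliptic over `ℝ`
  and `D < 0`: **`Ω(W) · Ω(W^{(D)}) · √(−D) = n · ∫_{E(ℂ)}|ω ∧ ω̄|`**, with
  `W^{(D)} = W.quadraticTwist D`, `n = numRealComponents W ∈ {1, 2}` (the twist has the same `n`)
  and `∫_{E(ℂ)}|ω ∧ ω̄| = complexPeriod (W ⊗ ℂ) = 2 covol(Λ)`;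
* `WeierstrassCurve.realPeriod_mul_realPeriod_quadraticTwist_eq_mul_bsdPeriod` — for `W/ℚ`
  elliptic and `K` imaginary quadratic (`IsTotallyComplex K`, `[K : ℚ] = 2`) of discriminant
  `D = d_K`: **`Ω(W ⊗ ℝ) · Ω(W^{(D)} ⊗ ℝ) = n · bsdPeriod (W_K)`**.

Proof (classical; Cremona, *Algorithms for Modular Elliptic Curves*, §3.7; Gross–Zagier 1986, the
normalisation `‖ω‖² = ∫_{E(ℂ)}|ω ∧ ω̄| = 2 covol`): let `Λ` be the period lattice of `W`
(`g₂ = c₄/12`, `g₃ = c₆/216`), a real lattice with least positive real period `Ω₀` and least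
positive real period `Ω₀'` of `iΛ`. Then `Ω(W) = n Ω₀` (`exists_periodPair_realPeriod_eq_holds`);
the lattice `(i/√(−D))Λ` has invariants `D² c₄/12`, `D³ c₆/216`, those of `W^{(D)}`
(`quadraticTwist_c₄`, `quadraticTwist_c₆`), so `Ω(W^{(D)}) = n Ω₀'/√(−D)` (`Δ(W^{(D)}) = D⁶Δ` has
the sign of `Δ`); and `n Ω₀ Ω₀' = 2 covol(Λ)` is the covolume of a real lattice
(`PeriodPair.IsReal.two_mul_covolume_eq`, file `RealLatticeCovolumeProofs`: rectangular lattices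
have `covol = Ω₀Ω₀'` and `n = 2`, rhombic ones `covol = Ω₀Ω₀'/2` and `n = 1`). Over `K`, the only
infinite place is complex and `bsdPeriod (W_K) = complexPeriod (W ⊗ ℂ)/√|d_K|` with `d_K < 0`
(`NumberField.sign_discr`).

What is NOT here: the passage to globally minimal models (`realPeriod_smul`, `bsdPeriod_smul'`:
factors `|u|`, `|N_{K/ℚ}(u)|`), and the non-archimedean, torsion and `Ш` terms of Milne's theorem,
which need global duality (see the notes of the unit proving `bsdRHS_baseChange_quadratic`).

## References

* J. S. Milne, *On the arithmetic of abelian varieties*, Invent. Math. 17 (1972), §1 (the period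
  and discriminant factor of a Weil restriction). [Milne1972ArithmeticAV]
* T. Dokchitser, V. Dokchitser, Ann. of Math. 172 (2010), §2.1, Conj. 2.1 (`C(E/K)`, periods at
  complex places, `|Δ_K|^{1/2}`). [DokchitserDokchitserAnnals2010]
* J. E. Cremona, *Algorithms for Modular Elliptic Curves*, 2nd ed. (1997), §3.7 (real and complex
  periods, `Δ > 0` rectangular / `Δ < 0`). [CremonaAlgorithms1997]
* B. Gross, D. Zagier, Invent. Math. 84 (1986), I §7 (`‖ω‖² = ∫_{E(ℂ)}|ω ∧ ω̄|`).
  [GrossZagierInvent1986]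
* J. H. Silverman, *The Arithmetic of Elliptic Curves*, 2nd ed. (2009), VI.5.1, C.16, X.2.
  [SilvermanAEC2009]

## Design notes

Theorems only (kernel-reviewed sibling); deliberate dot-notation extensions of Mathlib's
`WeierstrassCurve` namespace as in the rest of the topic. `map_quadraticTwist` (file
`QuadraticTwistPadicReduction`) is re-derived privately rather than importing the `p`-adic files.
-/

noncomputable section

open scoped Classical
open Complex
/-! ## The archimedean comparison for an elliptic curve over `ℝ` and its twist by `D < 0` -/

namespace WeierstrassCurve

section Real

variable (W : WeierstrassCurve ℝ) [W.IsElliptic]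

/-- **`Ω(W) = n · Ω₀(Λ)` for every period lattice of `W`**: the real period of an elliptic curve
over `ℝ` is the number of real components times the least positive real period of *any* period
pair with `g₂ = c₄/12`, `g₃ = c₆/216` (`exists_periodPair_realPeriod_eq_holds`, transported by the
uniqueness of the lattice, `PeriodPair.uniformization_unique_holds`). Silverman, *AEC*, C.16.
[cite: SilvermanAEC2009, Thm VI.5.1 and C.16] -/
theorem realPeriod_eq_numRealComponents_mul_minRealPeriod {L : PeriodPair}
    (h₂ : L.g₂ = ((W.c₄ / 12 : ℝ) : ℂ)) (h₃ : L.g₃ = ((W.c₆ / 216 : ℝ) : ℂ)) :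
    W.realPeriod = W.numRealComponents * L.minRealPeriod := by
  obtain ⟨L₁, h₁₂, h₁₃, hΩ⟩ := W.exists_periodPair_realPeriod_eq_holds
  have hlat : L₁.lattice = L.lattice :=
    PeriodPair.uniformization_unique_holds _ _ (h₁₂.trans h₂.symm) (h₁₃.trans h₃.symm)
  rw [hΩ, ← PeriodPair.minRealPeriod_def, PeriodPair.minRealPeriod_eq_of_lattice_eq hlat]

omit [W.IsElliptic] in
/-- A period pair with the (real) invariants of a curve over `ℝ` spans a real lattice
(`PeriodPair.isReal_of_g₂_g₃_real`). [folklore] -/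
theorem isReal_of_g₂_eq_of_g₃_eq {L : PeriodPair}
    (h₂ : L.g₂ = ((W.c₄ / 12 : ℝ) : ℂ)) (h₃ : L.g₃ = ((W.c₆ / 216 : ℝ) : ℂ)) : L.IsReal :=
  PeriodPair.isReal_of_g₂_g₃_real PeriodPair.uniformization_unique_holds
    (by rw [h₂, Complex.ofReal_im]) (by rw [h₃, Complex.ofReal_im])

omit [W.IsElliptic] in
/-- For such a pair, `g₂³ − 27g₃² = Δ(W)` (`(c₄/12)³ − 27(c₆/216)² = Δ`, Silverman *AEC* III.1).
[folklore] -/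
theorem discr_eq_Δ_of_g₂_eq_of_g₃_eq {L : PeriodPair}
    (h₂ : L.g₂ = ((W.c₄ / 12 : ℝ) : ℂ)) (h₃ : L.g₃ = ((W.c₆ / 216 : ℝ) : ℂ)) :
    L.g₂.re ^ 3 - 27 * L.g₃.re ^ 2 = W.Δ := by
  rw [h₂, h₃, Complex.ofReal_re, Complex.ofReal_re]
  exact W.c₄_div_cube_sub_eq_Δ

omit [W.IsElliptic] in
/-- For such a pair, the complex period of `W ⊗ ℂ` is `2 covol(Λ)` (`complexPeriod_eq_two_mul_covolume'`).
[folklore] -/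
theorem complexPeriod_map_eq_two_mul_covolume {L : PeriodPair}
    (h₂ : L.g₂ = ((W.c₄ / 12 : ℝ) : ℂ)) (h₃ : L.g₃ = ((W.c₆ / 216 : ℝ) : ℂ)) :
    (W.map (algebraMap ℝ ℂ)).complexPeriod = 2 * ZLattice.covolume L.lattice :=
  (W.map (algebraMap ℝ ℂ)).complexPeriod_eq_two_mul_covolume'
    (by rw [h₂, map_c₄]; push_cast; rfl) (by rw [h₃, map_c₆]; push_cast; rfl)

omit [W.IsElliptic] in
/-- The quadratic twist by `D ≠ 0` has the same number of real components
(`Δ(W^{(D)}) = D⁶ Δ(W)` has the sign of `Δ(W)`). [folklore] -/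
theorem numRealComponents_quadraticTwist {D : ℝ} (hD : D ≠ 0) :
    (W.quadraticTwist D).numRealComponents = W.numRealComponents := by
  have h6 : 0 < D ^ 6 := by positivity
  simp only [numRealComponents, quadraticTwist_Δ, mul_pos_iff_of_pos_left h6]

/-- **Archimedean comparison, real form.** For an elliptic curve `W` over `ℝ` and `D < 0`:
`Ω(W) · Ω(W^{(D)}) · √(−D) = n · ∫_{E(ℂ)} |ω ∧ ω̄|`, where `Ω = realPeriod = ∫_{E(ℝ)}|ω|`,
`W^{(D)} = W.quadraticTwist D` (the model `y² = x³ + D b₂/4 x² + D² b₄/2 x + D³ b₆/4`, with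
`c₄(W^{(D)}) = D² c₄`, `c₆(W^{(D)}) = D³ c₆`), `n = numRealComponents W` (`= 2` if `Δ > 0`, `1` if
`Δ < 0`; the twist has the same `n`) and `∫_{E(ℂ)}|ω ∧ ω̄| = complexPeriod (W ⊗ ℂ) = 2 covol(Λ)`.
Proof: if `Λ` is the period lattice of `W` then `(i/√(−D)) Λ` is that of `W^{(D)}`
(`g₂(cΛ) = c⁻⁴ g₂`, `g₃(cΛ) = c⁻⁶ g₃` with `c⁻² = D`), so `Ω(W) = nΩ₀`,
`Ω(W^{(D)}) = n Ω₀'/√(−D)` (`Ω₀'` the least positive real period of `iΛ`), and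
`n Ω₀ Ω₀' = 2 covol(Λ)` (`PeriodPair.IsReal.two_mul_covolume_eq`). This is the classical relation
between the real and imaginary periods and the area of the period parallelogram behind the period
of `E` over an imaginary quadratic field (Gross–Zagier 1986: the normalisation
`‖ω‖² = ∫_{E(ℂ)}|ω ∧ ω̄|`; Cremona, *Algorithms*, §2.10, pp. 29–30). [folklore] -/
theorem realPeriod_mul_realPeriod_quadraticTwist_mul_sqrt {D : ℝ} (hD : D < 0) :
    W.realPeriod * (W.quadraticTwist D).realPeriod * Real.sqrt (-D) =
      W.numRealComponents * (W.map (algebraMap ℝ ℂ)).complexPeriod := by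
  have hD0 : D ≠ 0 := hD.ne
  have hnegD : 0 < -D := neg_pos.mpr hD
  haveI : (W.quadraticTwist D).IsElliptic := W.isElliptic_quadraticTwist hD0
  obtain ⟨L, h₂, h₃⟩ : ∃ L : PeriodPair, L.g₂ = ((W.c₄ / 12 : ℝ) : ℂ) ∧
      L.g₃ = ((W.c₆ / 216 : ℝ) : ℂ) := by
    obtain ⟨L, h₂, h₃, -⟩ := W.exists_periodPair_realPeriod_eq_holds
    exact ⟨L, h₂, h₃⟩
  have hreal : L.IsReal := W.isReal_of_g₂_eq_of_g₃_eq h₂ h₃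
  -- the period lattice of the twist: `(i/√(-D)) Λ`
  set t : ℝ := (Real.sqrt (-D))⁻¹ with ht
  have hsqrt : 0 < Real.sqrt (-D) := Real.sqrt_pos.mpr hnegD
  have htpos : 0 < t := inv_pos.mpr hsqrt
  have ht2 : t ^ 2 = (-D)⁻¹ := by rw [ht, inv_pow, Real.sq_sqrt hnegD.le]
  have ht2C : (t : ℂ) ^ 2 = ((-D : ℝ) : ℂ)⁻¹ := by exact_mod_cast ht2
  have ht4 : ((t : ℂ) ^ 4)⁻¹ = (D : ℂ) ^ 2 := by
    rw [show (t : ℂ) ^ 4 = ((t : ℂ) ^ 2) ^ 2 by ring, ht2C, inv_pow, inv_inv]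
    push_cast; ring
  have ht6 : ((t : ℂ) ^ 6)⁻¹ = -(D : ℂ) ^ 3 := by
    rw [show (t : ℂ) ^ 6 = ((t : ℂ) ^ 2) ^ 3 by ring, ht2C, inv_pow, inv_inv]
    push_cast; ring
  have htC : (t : ℂ) ≠ 0 := by exact_mod_cast htpos.ne'
  set LD := (L.mulLeft I I_ne_zero).mulLeft (t : ℂ) htC with hLD
  have hLD₂ : LD.g₂ = (((W.quadraticTwist D).c₄ / 12 : ℝ) : ℂ) := by
    rw [hLD, PeriodPair.g₂_mulLeft, PeriodPair.g₂_mulLeft_I, h₂, ht4, quadraticTwist_c₄]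
    push_cast; ring
  have hLD₃ : LD.g₃ = (((W.quadraticTwist D).c₆ / 216 : ℝ) : ℂ) := by
    rw [hLD, PeriodPair.g₃_mulLeft, PeriodPair.g₃_mulLeft_I, h₃, ht6, quadraticTwist_c₆]
    push_cast; ring
  -- real periods
  have hΩW : W.realPeriod = W.numRealComponents * L.minRealPeriod :=
    W.realPeriod_eq_numRealComponents_mul_minRealPeriod h₂ h₃
  have hΩD : (W.quadraticTwist D).realPeriod =
      W.numRealComponents * (t * (L.mulLeft I I_ne_zero).minRealPeriod) := by
    rw [(W.quadraticTwist D).realPeriod_eq_numRealComponents_mul_minRealPeriod hLD₂ hLD₃,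
      W.numRealComponents_quadraticTwist hD0]
    congr 1
    exact (L.mulLeft I I_ne_zero).minRealPeriod_mulLeft_ofReal htpos
  -- covolume
  have hΔ0 : W.Δ ≠ 0 := W.isUnit_Δ.ne_zero
  have hdisc : L.g₂.re ^ 3 - 27 * L.g₃.re ^ 2 = W.Δ := W.discr_eq_Δ_of_g₂_eq_of_g₃_eq h₂ h₃
  have hcov := hreal.two_mul_covolume_eq (by rw [hdisc]; exact hΔ0)
  rw [hdisc] at hcov
  have hn : (W.numRealComponents : ℝ) = if 0 < W.Δ then 2 else 1 := by
    simp only [numRealComponents, Nat.cast_ite, Nat.cast_ofNat, Nat.cast_one]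
  rw [W.complexPeriod_map_eq_two_mul_covolume h₂ h₃, hcov, hΩW, hΩD, hn, ht]
  field_simp

end Real

/-! ## Over a number field: the BSD period of `W_K` for `K` imaginary quadratic -/

section NumberField

open NumberField

/-- Base change commutes with the quadratic twist (the twist is given by universal formulas in the
`bᵢ`). Private copy of `WeierstrassCurve.map_quadraticTwist` (file `QuadraticTwistPadicReduction`,
not imported to keep this archimedean file independent of the `p`-adic ones). [folklore] -/
private theorem map_quadraticTwist_aux {F L : Type*} [Field F] [Field L] (V : WeierstrassCurve F)
    (f : F →+* L) (d : F) : (V.quadraticTwist d).map f = (V.map f).quadraticTwist (f d) := by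
  ext
  · simp
  · simp [map_div₀, map_ofNat]
  · simp
  · simp [map_div₀, map_ofNat]
  · simp [map_div₀, map_ofNat]

/-- A totally complex quadratic field has negative discriminant (`sign d_K = (−1)^{r₂}`, Mathlib
`NumberField.sign_discr`, `r₂ = 1`). [folklore] -/
theorem discr_neg_of_finrank_eq_two (K : Type*) [Field K] [NumberField K] [IsTotallyComplex K]
    (h2 : Module.finrank ℚ K = 2) : NumberField.discr K < 0 := by
  have h1 : InfinitePlace.nrComplexPlaces K = 1 := by
    have := IsTotallyComplex.finrank K
    omega
  have h := NumberField.sign_discr K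
  rw [h1, pow_one] at h
  exact Int.sign_eq_neg_one_iff_neg.mp h

/-- **Archimedean comparison, number-field form** (the archimedean part of Milne's comparison of
the BSD data of `E_K` and of `E × E^{(D)}`, Milne 1972 §1; in the normalisation of
Dokchitser–Dokchitser 2010, Conj. 2.1: `2∫_{E(K_v)} ω ∧ ω̄ / |Δ_K|^{1/2}` at the complex place).
For `W/ℚ` elliptic and `K` an imaginary quadratic field of discriminant `D = d_K`:
`Ω(W) · Ω(W^{(D)}) = n · Ω(W_K/K)`, where `Ω(W) = realPeriod (W ⊗ ℝ)` (`= realPeriodRat W`),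
`W^{(D)} = W.quadraticTwist D`, `n = numRealComponents (W ⊗ ℝ) ∈ {1, 2}` and
`Ω(W_K/K) = bsdPeriod (W.baseChange K) = 2 covol(Λ_W)/√|d_K|` (`bsdPeriod_eq_of_card_eq_one`).
(For the BSD right-hand sides one passes to globally minimal models of `W^{(D)}` over `ℚ` and of
`W_K` over `K` with `realPeriod_smul` / `bsdPeriod_smul'`.) [folklore] -/
theorem realPeriod_mul_realPeriod_quadraticTwist_eq_mul_bsdPeriod (W : WeierstrassCurve ℚ)
    [W.IsElliptic] (K : Type*) [Field K] [NumberField K] [IsTotallyComplex K]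
    (h2 : Module.finrank ℚ K = 2) :
    (W.baseChange ℝ).realPeriod *
        ((W.quadraticTwist (NumberField.discr K : ℚ)).baseChange ℝ).realPeriod =
      (W.baseChange ℝ).numRealComponents * (W.baseChange K).bsdPeriod := by
  have hd : NumberField.discr K < 0 := discr_neg_of_finrank_eq_two K h2
  have hD : ((NumberField.discr K : ℚ) : ℝ) < 0 := by exact_mod_cast hd
  haveI : (W.baseChange ℝ).IsElliptic := by rw [WeierstrassCurve.baseChange]; infer_instance
  have htw : (W.quadraticTwist (NumberField.discr K : ℚ)).baseChange ℝ =
      (W.baseChange ℝ).quadraticTwist ((NumberField.discr K : ℚ) : ℝ) := by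
    rw [WeierstrassCurve.baseChange, map_quadraticTwist_aux, eq_ratCast]
    rfl
  obtain ⟨w⟩ : Nonempty (InfinitePlace K) := inferInstance
  have hcard := card_infinitePlace_eq_one_of_finrank_eq_two (K := K) h2
  have hmap : (W.baseChange K).map w.embedding = (W.baseChange ℝ).map (algebraMap ℝ ℂ) := by
    rw [WeierstrassCurve.baseChange, WeierstrassCurve.baseChange, map_map, map_map]
    congr 1
    exact Subsingleton.elim _ _
  rw [(W.baseChange K).bsdPeriod_eq_of_card_eq_one hcard w,
    (W.baseChange K).placePeriod_of_isTotallyComplex w, hmap, htw]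
  have key := (W.baseChange ℝ).realPeriod_mul_realPeriod_quadraticTwist_mul_sqrt hD
  have habs : |((NumberField.discr K : ℤ) : ℝ)| = -((NumberField.discr K : ℚ) : ℝ) := by
    rw [abs_of_neg (by exact_mod_cast hd)]
    push_cast; ring
  rw [habs]
  have hsqrt : 0 < Real.sqrt (-((NumberField.discr K : ℚ) : ℝ)) :=
    Real.sqrt_pos.mpr (neg_pos.mpr hD)
  rw [eq_comm, mul_div_assoc', div_eq_iff hsqrt.ne', eq_comm]
  exact key

end NumberField

end WeierstrassCurve

end
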